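import Summits.BirchSwinnertonDyer.BirchSwinnertonDyer.Theorems.ResidualThetaTransportAtTwoKatoZetaDefs
import Summits.BirchSwinnertonDyer.BirchSwinnertonDyer.Theorems.ResidualThetaTransportAtTwoResidualSignedLambdaLowerCMAtTwoTwoCurrencyDescent
import Summits.BirchSwinnertonDyer.BirchSwinnertonDyer.Theorems.ResidualThetaTransportAtTwoLambdaLowerBoundOExact
import Summits.BirchSwinnertonDyer.BirchSwinnertonDyer.Theorems.ResidualThetaTransportAtTwoResidualSignedLambdaLowerCMAtTwoColemanSideInjective
import HarnessLib

/-!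
# Sketch (stub-ideation k = 1, gen 34, technique «weaken / strengthen») — crux `ResidualThetaCountLowerPureAtTwo`
# (stmt-BirchSwinnertonDyer-26074), stub `stub_cmLambdaLower` (= RSL_g, closed mod print since v8; the LEAD's prepared v9 keeps
# the ∀-form child B `stub_kzgChildB` as the only non-cite open leaf under it)

STRONGEST PROVABLE FORM / WEAKEST SUFFICIENT FORM of the kept ∀-child-B, paid in the kernel.

The ∀-child-B says: every *valued class* `(z, c′, w, q, μ̃)` at a frame has (ii_fin) `Frac𝒪 ⊗ 𝐇¹/Λz` finite and
(ii_λ) `λ(𝐇¹/Λz) ≤ λ(X₀) + λ(Λ/μ̃)`.  Split it at the witness `z₁` (Kato's class, «Kato125AB», which has (FIN₁) and (LAM₁)):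

* §1 (generic algebra over `Λ = A⟦X⟧`, `A` a domain, `K = Frac A`; PROVED):
  (L1) `isTorsion_of_finite_baseChange` — **`K ⊗_A M` finite-dimensional ⇒ `M` is `Λ`-torsion**, for ANY `Λ`-module `M`
  (no finite generation) = the TREE's `ColemanSideInjective.isTorsion_of_finite_baseChange` (k3-g12) at `K = Frac A`, cited, not re-proved;
  (L2) `exists_smul_eq_smul_of_isTorsion` — **commensurability** `s₁•z = s₂•z₁`, `s₁ s₂ ≠ 0`, of a torsion-free `z` with `z₁` when
  `H/Λz₁` is torsion; (L4) `finite_baseChange_quot_of_smul_mem` — (ii_fin) TRANSFERS along a commensurability, WITHOUT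
  `Module.Finite Λ H` (right-exactness of `K ⊗_A ·` on `Λ/(s) → H/Λsz₁ → H/Λz₁ → 0`); (L5) the decoration shift
  `λ(H/ΛDz) = λ(H/Λz) + λ(Λ/(D))` WITHOUT `Module.Finite Λ H` (hypothesis `K ⊗ H/Λz` finite instead); (A2′) the SLACK EQUATION of a
  commensurable pair `λ(H/Λz) + λ(Λ/s₁) = λ(H/Λz₁) + λ(Λ/s₂)`; (B≡|RATIO) slack invariance
  `λ(H/Λz) + λ(Λ/μ̃₁) = λ(H/Λz₁) + λ(Λ/μ̃)` from the single RATIO RELATION `C a·μ̃·s₁ = C a′·μ̃₁·s₂`; (B≤|DVD) the one-sided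
  comparison `… ≤ …` from the ONE-SIDED relation `C a·μ̃·s₁ = t·μ̃₁·s₂` (`t ∈ Λ` arbitrary) — the WEAKEST sufficient station.
* §2 (over the tree's `OnePairPins` / `zetaQuot` / `lamO`; PROVED): (T1) every class with `e(𝒸 z) ≠ 0` — in particular every valued
  class, by station (R)'s landed output `C ν·e(𝒸 z) = μ̃·L⁻·u` — is `Λ_𝒪`-torsion-free; (T2) **the (ii_fin)-half of the ∀-child-B holds
  at every torsion-free class modulo (FIN₁) of ONE class** (`childBFin_of_witness`), K0b-free and without `Module.Finite Λ_𝒪 𝐇¹`;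
  (T3) the (ii_λ)-half follows from (FIN₁)+(LAM₁) and the RATIO RELATION for the pair `(z, z₁)` (`childB_pair_of_witness`),
  or already from the one-sided relation (`childB_pair_of_witness_dvd`);
  (T4) `RatioRelationStatement` — the e-free analytic station ((U)+(Θ)+(P) of Ideas/stub-cmlambdalower-k1-g31), TYPED ONLY;
  (T5) `childB_pair_of_sharpR` — child B from the landed stations' PROOF SHAPES ((E) global, (R) with the frame term `𝔯̃_e(c′)`
  exposed) + frame-term λ-monotonicity; (E♭) `CoeffwiseTrivialisationStatement` (TYPED: the tree's `e` is coefficientwise —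
  `PriceNode.exists_coeffwise_addEquiv` — re-exported) and `rtilde_eq_C_of_coeffwise` (PROVED: then `𝔯̃ = C β`);
  (T6) `childB_pair_of_constUnitR` — **child B at every valued class from «Kato125AB» + (E♭) + (R♭: (R) re-exported with
  `u = C k·unit`)**: the whole ∀-child-B beyond print is TWO RE-EXPORTS of landed proofs plus this file.

THEOREMS + two Prop-valued defs (typed stations); no `sorry`, no axiom, no instance.  BSD is NOT proved by anything here; items 26074 / 22608 stay
OPEN; «Kato125AB» (print) and the ratio station remain open.
-/

set_option autoImplicit false
set_option linter.dupNamespace false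
set_option backward.isDefEq.respectTransparency false

noncomputable section

open scoped Classical NumberField TensorProduct nonZeroDivisors

namespace Summit.BirchSwinnertonDyer.BirchSwinnertonDyer.Cruxes.ResidualThetaCountLowerPureAtTwo.SideaK1G34

open Literature.NumberTheory.EllipticCurves Literature.NumberTheory.EllipticCurves.GreenbergSelmer
open Literature.NumberTheory.GaloisRepresentations NumberField IsDedekindDomain Field
open GreenbergVatsal2000 Kobayashi2003 Rat.HeightOneSpectrum
open Summit.BirchSwinnertonDyer.BirchSwinnertonDyer.Theorems
open Summit.BirchSwinnertonDyer.BirchSwinnertonDyer.Theorems.OnePair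

universe u w

/-! ## §1 Generic algebra over `Λ = A⟦X⟧` -/

section Generic

variable {A : Type u} [CommRing A] [IsDomain A] (K : Type w) [Field K] [Algebra A K] [IsFractionRing A K]

/-- **(L1) `K ⊗_A M` finite-dimensional ⇒ `M` is `Λ`-torsion — for ANY `Λ = A⟦X⟧`-module `M` (no finite generation).**
This is the TREE's TORS lemma `ColemanSideInjective.isTorsion_of_finite_baseChange` (+ `not_finite_baseChange_powerSeries`; credit card
k3-g12 §1), specialised to `K = Frac A` (flat) — restated here only to fix the binder shape used below. [cite: Washington1997, §13.2] -/
theorem isTorsion_of_finite_baseChange {M : Type*} [AddCommGroup M] [Module (PowerSeries A) M] [Module A M]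
    [IsScalarTower A (PowerSeries A) M] [Module.Finite K (K ⊗[A] M)] :
    Module.IsTorsion (PowerSeries A) M := by
  -- the tree's TORS lemma (`ColemanSideInjective`, credit card k3-g12 §1), specialised to `Λ = A⟦X⟧`, `K = Frac A`
  haveI : Module.Flat A K := IsLocalization.flat K (nonZeroDivisors A)
  exact Summit.BirchSwinnertonDyer.BirchSwinnertonDyer.Theorems.ColemanSideInjective.isTorsion_of_finite_baseChange K
    (Summit.BirchSwinnertonDyer.BirchSwinnertonDyer.Theorems.ColemanSideInjective.not_finite_baseChange_powerSeries K)

/-- **(L2) Commensurability of a torsion-free class with a class of torsion quotient.** If `H/Λz₁` is `Λ`-torsion and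
`a•z = 0 ⇒ a = 0`, then `s₁•z = s₂•z₁` for some `s₁, s₂ ∈ Λ ∖ 0` (station (K) of Ideas/stub-cmlambdalower-k1-g31, here K0b-free:
the torsion hypothesis comes from (L1), not from rank one). [cite: Kato2004Asterisque, Thm. 12.4 (2) (p. 221)] -/
theorem exists_smul_eq_smul_of_isTorsion {H : Type*} [AddCommGroup H] [Module (PowerSeries A) H] {z z₁ : H}
    (htors : Module.IsTorsion (PowerSeries A) (H ⧸ Submodule.span (PowerSeries A) ({z₁} : Set H)))
    (hz : ∀ a : PowerSeries A, a • z = 0 → a = 0) :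
    ∃ s₁ s₂ : PowerSeries A, s₁ ≠ 0 ∧ s₂ ≠ 0 ∧ s₁ • z = s₂ • z₁ := by
  obtain ⟨⟨s₁, hs₁⟩, h⟩ := @htors (Submodule.Quotient.mk z)
  rw [Submonoid.mk_smul, ← Submodule.Quotient.mk_smul, Submodule.Quotient.mk_eq_zero,
    Submodule.mem_span_singleton] at h
  obtain ⟨s₂, hs₂⟩ := h
  refine ⟨s₁, s₂, nonZeroDivisors.ne_zero hs₁, ?_, hs₂.symm⟩
  rintro rfl
  rw [zero_smul] at hs₂
  exact nonZeroDivisors.ne_zero hs₁ (hz _ hs₂.symm)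

omit [IsDomain A] in
/-- **The comparison sequence `Λ/(s) → H/Λ(s•z) → H/Λz → 0`** (exact, and `Λ/(s) → H/Λ(s•z)` injective when `z` is torsion-free):
the maps and their properties, packaged. [cite: Washington1997, §13.2] -/
theorem exists_exact_quot_span_smul {H : Type*} [AddCommGroup H] [Module (PowerSeries A) H] (z : H) (s : PowerSeries A) :
    ∃ (i : (PowerSeries A ⧸ Ideal.span {s}) →ₗ[PowerSeries A] (H ⧸ Submodule.span (PowerSeries A) ({s • z} : Set H)))
      (π : (H ⧸ Submodule.span (PowerSeries A) ({s • z} : Set H)) →ₗ[PowerSeries A]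
        (H ⧸ Submodule.span (PowerSeries A) ({z} : Set H))),
      Function.Exact i π ∧ Function.Surjective π ∧
        ((∀ a : PowerSeries A, a • z = 0 → a = 0) → Function.Injective i) := by
  set Λz := Submodule.span (PowerSeries A) ({z} : Set H) with hΛz
  set Λsz := Submodule.span (PowerSeries A) ({s • z} : Set H) with hΛsz
  have hle : Λsz ≤ Λz := by
    rw [hΛsz, Submodule.span_singleton_le_iff_mem]
    exact Submodule.smul_mem _ _ (Submodule.mem_span_singleton_self z)
  have hker_le : Ideal.span {s} ≤
      LinearMap.ker ((Λsz.mkQ).comp (LinearMap.toSpanSingleton (PowerSeries A) H z)) := by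
    rw [Ideal.span_le]
    rintro _ ⟨rfl⟩
    rw [SetLike.mem_coe, LinearMap.mem_ker, LinearMap.comp_apply, LinearMap.toSpanSingleton_apply,
      Submodule.mkQ_apply, Submodule.Quotient.mk_eq_zero, hΛsz]
    exact Submodule.mem_span_singleton_self _
  let i : (PowerSeries A ⧸ Ideal.span {s}) →ₗ[PowerSeries A] (H ⧸ Λsz) :=
    Submodule.liftQ (Ideal.span {s}) ((Λsz.mkQ).comp (LinearMap.toSpanSingleton (PowerSeries A) H z)) hker_le
  let π : (H ⧸ Λsz) →ₗ[PowerSeries A] (H ⧸ Λz) := Submodule.factor hle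
  have hi_apply : ∀ a : PowerSeries A,
      i (Ideal.Quotient.mk (Ideal.span {s}) a) = Submodule.Quotient.mk (a • z) := fun a => rfl
  have hπ : Function.Surjective π := Submodule.factor_surjective hle
  have hexact : Function.Exact i π := by
    intro x
    constructor
    · intro hx
      induction x using Submodule.Quotient.induction_on with
      | H y =>
        have hy : y ∈ Λz := by
          rw [← Submodule.Quotient.mk_eq_zero]
          exact hx
        rw [hΛz, Submodule.mem_span_singleton] at hy
        obtain ⟨a, rfl⟩ := hy
        exact ⟨Ideal.Quotient.mk _ a, hi_apply a⟩
    · rintro ⟨a, rfl⟩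
      obtain ⟨a, rfl⟩ := Ideal.Quotient.mk_surjective a
      rw [hi_apply]
      change Submodule.factor hle (Λsz.mkQ (a • z)) = 0
      rw [Submodule.factor_mk, Submodule.mkQ_apply, Submodule.Quotient.mk_eq_zero, hΛz]
      exact Submodule.smul_mem _ _ (Submodule.mem_span_singleton_self z)
  refine ⟨i, π, hexact, hπ, fun hz => ?_⟩
  rw [← LinearMap.ker_eq_bot, Submodule.eq_bot_iff]
  intro x hx
  obtain ⟨a, rfl⟩ := Ideal.Quotient.mk_surjective x
  rw [LinearMap.mem_ker, hi_apply, Submodule.Quotient.mk_eq_zero, hΛsz, Submodule.mem_span_singleton] at hx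
  obtain ⟨b, hb⟩ := hx
  have hab : (b * s - a) • z = 0 := by rw [sub_smul, mul_smul, hb, sub_self]
  have := hz _ hab
  rw [Ideal.Quotient.eq_zero_iff_mem, Ideal.mem_span_singleton']
  exact ⟨b, by rw [sub_eq_zero] at this; exact this⟩

omit [IsDomain A] [IsFractionRing A K] in
/-- **(L4⁰) `K ⊗ (H/Q)` is finite if `K ⊗ (H/P)` is and `P ≤ Q`** (a quotient). -/
theorem finite_baseChange_quot_mono {H : Type*} [AddCommGroup H] [Module (PowerSeries A) H] [Module A H]
    [IsScalarTower A (PowerSeries A) H] {P Q : Submodule (PowerSeries A) H} (hPQ : P ≤ Q)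
    [Module.Finite K (K ⊗[A] (H ⧸ P))] : Module.Finite K (K ⊗[A] (H ⧸ Q)) := by
  refine Module.Finite.of_surjective (((Submodule.factor hPQ).restrictScalars A).baseChange K) ?_
  rw [LinearMap.baseChange_eq_ltensor]
  exact LinearMap.lTensor_surjective K (Submodule.factor_surjective hPQ)

variable [IsDiscreteValuationRing A] [IsAdicComplete (IsLocalRing.maximalIdeal A) A]

/-- **(L4¹) `K ⊗ H/Λ(s•z)` is finite if `K ⊗ H/Λz` is (`s ≠ 0`, `A` a complete DVR) — no `Module.Finite Λ H`:** right-exactness of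
`K ⊗_A ·` on `Λ/(s) → H/Λ(s•z) → H/Λz → 0` and `Module.Finite.of_exact`, the outer terms being finite
(`Λ/(s)`: `TwoCurrencyDescent.finite_baseChange_quotient_span_singleton`). [cite: Washington1997, §13.2 (Thm. 13.12, Prop. 13.8)] -/
theorem finite_baseChange_quot_span_smul {H : Type u} [AddCommGroup H] [Module (PowerSeries A) H] [Module A H]
    [IsScalarTower A (PowerSeries A) H] (z : H) {s : PowerSeries A} (hs : s ≠ 0)
    [Module.Finite K (K ⊗[A] (H ⧸ Submodule.span (PowerSeries A) ({z} : Set H)))] :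
    Module.Finite K (K ⊗[A] (H ⧸ Submodule.span (PowerSeries A) ({s • z} : Set H))) := by
  obtain ⟨i, π, hexact, hπ, -⟩ := exists_exact_quot_span_smul z s
  haveI : Module.Finite K (K ⊗[A] (PowerSeries A ⧸ Ideal.span {s})) :=
    CharIdealLambda.finite_baseChange_of_isTorsion K (PowerSeries A ⧸ Ideal.span {s})
      (ThetaTransport.TwoCurrencyDescent.isTorsion_quotient_span_singleton hs)
  have hexact' : Function.Exact ((i.restrictScalars A).baseChange K) ((π.restrictScalars A).baseChange K) := by
    rw [LinearMap.baseChange_eq_ltensor, LinearMap.baseChange_eq_ltensor]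
    exact lTensor_exact K hexact hπ
  have hπ' : Function.Surjective ((π.restrictScalars A).baseChange K) := by
    rw [LinearMap.baseChange_eq_ltensor]
    exact LinearMap.lTensor_surjective K hπ
  exact Module.Finite.of_exact hexact' hπ'

/-- **(L4) (ii_fin) TRANSFERS along a commensurability**: if `K ⊗ H/Λz₁` is finite and `s•z₁ ∈ Λz` with `s ≠ 0`, then
`K ⊗ H/Λz` is finite (`H/Λz` is a quotient of `H/Λ(s•z₁)`). No finite generation of `H`. [cite: Washington1997, §13.2] -/
theorem finite_baseChange_quot_of_smul_mem {H : Type u} [AddCommGroup H] [Module (PowerSeries A) H] [Module A H]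
    [IsScalarTower A (PowerSeries A) H] {z z₁ : H} {s : PowerSeries A} (hs : s ≠ 0)
    (hmem : s • z₁ ∈ Submodule.span (PowerSeries A) ({z} : Set H))
    [Module.Finite K (K ⊗[A] (H ⧸ Submodule.span (PowerSeries A) ({z₁} : Set H)))] :
    Module.Finite K (K ⊗[A] (H ⧸ Submodule.span (PowerSeries A) ({z} : Set H))) := by
  haveI := finite_baseChange_quot_span_smul K z₁ hs
  exact finite_baseChange_quot_mono K ((Submodule.span_singleton_le_iff_mem _ _).mpr hmem)

/-- **(L5) The decoration shift without `Module.Finite Λ H`:** for `z` torsion-free with `K ⊗ H/Λz` finite and `D ≠ 0`,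
`λ(H/ΛDz) = λ(H/Λz) + λ(Λ/(D))` (`0 → Λ/(D) → H/ΛDz → H/Λz → 0` and flat base change; the tree's
`CharIdealLambda.finrank_baseChange_quotient_span_smul_eq_add` assumes `Module.Finite Λ H` + torsion quotient instead).
[cite: Kato2004Asterisque, Thm. 12.4 (2) (p. 221)] [cite: Washington1997, §13.2] -/
theorem finrank_baseChange_quot_span_smul_eq_add {H : Type u} [AddCommGroup H] [Module (PowerSeries A) H] [Module A H]
    [IsScalarTower A (PowerSeries A) H] (z : H) (hz : ∀ a : PowerSeries A, a • z = 0 → a = 0)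
    {D : PowerSeries A} (hD : D ≠ 0)
    [Module.Finite K (K ⊗[A] (H ⧸ Submodule.span (PowerSeries A) ({z} : Set H)))] :
    Module.finrank K (K ⊗[A] (H ⧸ Submodule.span (PowerSeries A) ({D • z} : Set H))) =
      Module.finrank K (K ⊗[A] (H ⧸ Submodule.span (PowerSeries A) ({z} : Set H))) +
        Module.finrank K (K ⊗[A] (PowerSeries A ⧸ Ideal.span {D})) := by
  obtain ⟨i, π, hexact, hπ, hinj⟩ := exists_exact_quot_span_smul z D
  haveI := finite_baseChange_quot_span_smul K z hD
  have := LambdaLowerBoundO.finrank_baseChange_eq_of_exact_three K (i.restrictScalars A) (π.restrictScalars A)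
    (hinj hz) hexact hπ
  rw [this, add_comm]

/-- **(A2′) THE SLACK EQUATION of a commensurable pair** (no `Module.Finite Λ H`): `z, z₁` torsion-free, `s₁•z = s₂•z₁`,
`s₁ s₂ ≠ 0`, `K ⊗ H/Λz₁` finite ⇒ `λ(H/Λz) + λ(Λ/(s₁)) = λ(H/Λz₁) + λ(Λ/(s₂))` (both sides are `λ(H/Λs₁z) = λ(H/Λs₂z₁)`).
[cite: Kato2004Asterisque, Thm. 12.4 (2) (p. 221)] [cite: Washington1997, §13.2] -/
theorem slack_eq_of_smul_eq_smul {H : Type u} [AddCommGroup H] [Module (PowerSeries A) H] [Module A H]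
    [IsScalarTower A (PowerSeries A) H] {z z₁ : H} (hz : ∀ a : PowerSeries A, a • z = 0 → a = 0)
    (hz₁ : ∀ a : PowerSeries A, a • z₁ = 0 → a = 0) {s₁ s₂ : PowerSeries A} (hs₁ : s₁ ≠ 0) (hs₂ : s₂ ≠ 0)
    (h : s₁ • z = s₂ • z₁)
    [Module.Finite K (K ⊗[A] (H ⧸ Submodule.span (PowerSeries A) ({z₁} : Set H)))] :
    Module.finrank K (K ⊗[A] (H ⧸ Submodule.span (PowerSeries A) ({z} : Set H))) +
        Module.finrank K (K ⊗[A] (PowerSeries A ⧸ Ideal.span {s₁})) =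
      Module.finrank K (K ⊗[A] (H ⧸ Submodule.span (PowerSeries A) ({z₁} : Set H))) +
        Module.finrank K (K ⊗[A] (PowerSeries A ⧸ Ideal.span {s₂})) := by
  have hmem : s₂ • z₁ ∈ Submodule.span (PowerSeries A) ({z} : Set H) := by
    rw [← h]
    exact Submodule.smul_mem _ _ (Submodule.mem_span_singleton_self z)
  haveI := finite_baseChange_quot_of_smul_mem K hs₂ hmem
  have h1 := finrank_baseChange_quot_span_smul_eq_add K z hz hs₁
  have h2 := finrank_baseChange_quot_span_smul_eq_add K z₁ hz₁ hs₂
  rw [h] at h1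
  omega

/-- **(B≡ | RATIO) slack invariance from the ratio relation.** For a commensurable pair `s₁•z = s₂•z₁` of torsion-free classes
with multipliers `μ̃, μ̃₁ ≠ 0` tied by `C a·μ̃·s₁ = C a′·μ̃₁·s₂` (`a, a′ ∈ A ∖ 0`; constants are λ-invisible):
`λ(H/Λz) + λ(Λ/μ̃₁) = λ(H/Λz₁) + λ(Λ/μ̃)`.  [cite: Kato2004Asterisque, Thm. 12.5 (p. 222)] [cite: Washington1997, §13.2] -/
theorem slack_invariance_of_ratio {H : Type u} [AddCommGroup H] [Module (PowerSeries A) H] [Module A H]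
    [IsScalarTower A (PowerSeries A) H] {z z₁ : H} (hz : ∀ a : PowerSeries A, a • z = 0 → a = 0)
    (hz₁ : ∀ a : PowerSeries A, a • z₁ = 0 → a = 0) {s₁ s₂ μt μt₁ : PowerSeries A} {a a' : A}
    (hs₁ : s₁ ≠ 0) (hs₂ : s₂ ≠ 0) (hμ : μt ≠ 0) (hμ₁ : μt₁ ≠ 0) (ha : a ≠ 0) (ha' : a' ≠ 0)
    (hcomm : s₁ • z = s₂ • z₁)
    (hratio : PowerSeries.C a * μt * s₁ = PowerSeries.C a' * μt₁ * s₂)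
    [Module.Finite K (K ⊗[A] (H ⧸ Submodule.span (PowerSeries A) ({z₁} : Set H)))] :
    Module.finrank K (K ⊗[A] (H ⧸ Submodule.span (PowerSeries A) ({z} : Set H))) +
        Module.finrank K (K ⊗[A] (PowerSeries A ⧸ Ideal.span {μt₁})) =
      Module.finrank K (K ⊗[A] (H ⧸ Submodule.span (PowerSeries A) ({z₁} : Set H))) +
        Module.finrank K (K ⊗[A] (PowerSeries A ⧸ Ideal.span {μt})) := by
  have hA2 := slack_eq_of_smul_eq_smul K hz hz₁ hs₁ hs₂ hcomm
  -- `λ(Λ/(C a·μ̃·s₁)) = λ(Λ/(s₁)) + λ(Λ/μ̃)` and symmetrically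
  have hl : Module.finrank K (K ⊗[A] (PowerSeries A ⧸ Ideal.span {PowerSeries.C a * μt * s₁})) =
      Module.finrank K (K ⊗[A] (PowerSeries A ⧸ Ideal.span {s₁})) +
        Module.finrank K (K ⊗[A] (PowerSeries A ⧸ Ideal.span {μt})) := by
    have hC : (PowerSeries.C a : PowerSeries A) ≠ 0 := fun h0 => ha (by simpa using congrArg PowerSeries.constantCoeff h0)
    rw [CharIdealLambda.finrank_baseChange_quotient_span_mul_eq_add K (mul_ne_zero hC hμ) hs₁,
      CharIdealLambda.finrank_baseChange_quotient_span_C_mul_eq K ha hμ]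
  have hr : Module.finrank K (K ⊗[A] (PowerSeries A ⧸ Ideal.span {PowerSeries.C a' * μt₁ * s₂})) =
      Module.finrank K (K ⊗[A] (PowerSeries A ⧸ Ideal.span {s₂})) +
        Module.finrank K (K ⊗[A] (PowerSeries A ⧸ Ideal.span {μt₁})) := by
    have hC : (PowerSeries.C a' : PowerSeries A) ≠ 0 := fun h0 => ha' (by simpa using congrArg PowerSeries.constantCoeff h0)
    rw [CharIdealLambda.finrank_baseChange_quotient_span_mul_eq_add K (mul_ne_zero hC hμ₁) hs₂,
      CharIdealLambda.finrank_baseChange_quotient_span_C_mul_eq K ha' hμ₁]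
  rw [hratio] at hl
  omega

/-- **(B≤|DVD) One-sided slack comparison from a ONE-SIDED ratio relation — the WEAKEST sufficient station.** If
`C a·μ̃·s₁ = t·μ̃₁·s₂` with `a ∈ A ∖ 0` a CONSTANT but `t ∈ Λ ∖ 0` ARBITRARY («`μ̃₁·s₂` divides `μ̃·s₁` up to a constant»), then
`λ(H/Λz) + λ(Λ/μ̃₁) ≤ λ(H/Λz₁) + λ(Λ/μ̃)` — exactly the hypothesis of `iiLam_of_slack_le`; strictly weaker than (B≡|RATIO). -/
theorem slack_le_of_dvd_ratio {H : Type u} [AddCommGroup H] [Module (PowerSeries A) H] [Module A H]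
    [IsScalarTower A (PowerSeries A) H] {z z₁ : H} (hz : ∀ a : PowerSeries A, a • z = 0 → a = 0)
    (hz₁ : ∀ a : PowerSeries A, a • z₁ = 0 → a = 0) {s₁ s₂ μt μt₁ t : PowerSeries A} {a : A}
    (hs₁ : s₁ ≠ 0) (hs₂ : s₂ ≠ 0) (hμ : μt ≠ 0) (hμ₁ : μt₁ ≠ 0) (ha : a ≠ 0) (ht : t ≠ 0)
    (hcomm : s₁ • z = s₂ • z₁)
    (hdvd : PowerSeries.C a * μt * s₁ = t * μt₁ * s₂)
    [Module.Finite K (K ⊗[A] (H ⧸ Submodule.span (PowerSeries A) ({z₁} : Set H)))] :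
    Module.finrank K (K ⊗[A] (H ⧸ Submodule.span (PowerSeries A) ({z} : Set H))) +
        Module.finrank K (K ⊗[A] (PowerSeries A ⧸ Ideal.span {μt₁})) ≤
      Module.finrank K (K ⊗[A] (H ⧸ Submodule.span (PowerSeries A) ({z₁} : Set H))) +
        Module.finrank K (K ⊗[A] (PowerSeries A ⧸ Ideal.span {μt})) := by
  have hA2 := slack_eq_of_smul_eq_smul K hz hz₁ hs₁ hs₂ hcomm
  have hl : Module.finrank K (K ⊗[A] (PowerSeries A ⧸ Ideal.span {PowerSeries.C a * μt * s₁})) =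
      Module.finrank K (K ⊗[A] (PowerSeries A ⧸ Ideal.span {s₁})) +
        Module.finrank K (K ⊗[A] (PowerSeries A ⧸ Ideal.span {μt})) := by
    have hC : (PowerSeries.C a : PowerSeries A) ≠ 0 := fun h0 => ha (by simpa using congrArg PowerSeries.constantCoeff h0)
    rw [CharIdealLambda.finrank_baseChange_quotient_span_mul_eq_add K (mul_ne_zero hC hμ) hs₁,
      CharIdealLambda.finrank_baseChange_quotient_span_C_mul_eq K ha hμ]
  have hr : Module.finrank K (K ⊗[A] (PowerSeries A ⧸ Ideal.span {t * μt₁ * s₂})) =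
      Module.finrank K (K ⊗[A] (PowerSeries A ⧸ Ideal.span {s₂})) +
        (Module.finrank K (K ⊗[A] (PowerSeries A ⧸ Ideal.span {μt₁})) +
          Module.finrank K (K ⊗[A] (PowerSeries A ⧸ Ideal.span {t}))) := by
    rw [CharIdealLambda.finrank_baseChange_quotient_span_mul_eq_add K (mul_ne_zero ht hμ₁) hs₂,
      CharIdealLambda.finrank_baseChange_quotient_span_mul_eq_add K ht hμ₁]
  rw [hdvd] at hl
  omega

/-- **Constants and units are invisible to `λ`:** `λ(Λ/(C a·C b·(U·x))) = λ(Λ/(x))` for `a, b ∈ A ∖ 0`, `U ∈ Λˣ`. -/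
theorem finrank_baseChange_quot_span_C_mul_C_mul_unit_mul {a b : A} {U x : PowerSeries A} (ha : a ≠ 0) (hb : b ≠ 0)
    (hU : IsUnit U) (hx : x ≠ 0) :
    Module.finrank K (K ⊗[A] (PowerSeries A ⧸ Ideal.span {PowerSeries.C a * PowerSeries.C b * (U * x)})) =
      Module.finrank K (K ⊗[A] (PowerSeries A ⧸ Ideal.span {x})) := by
  rw [← map_mul, CharIdealLambda.finrank_baseChange_quotient_span_C_mul_eq K (mul_ne_zero ha hb) (mul_ne_zero hU.ne_zero hx),
    Ideal.span_singleton_mul_left_unit hU]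

/-- **(B≤|BAL) One-sided slack comparison from a BALANCED ratio relation — the weakest sufficient ALGEBRAIC station.** If
`t·μ̃·s₁ = t′·μ̃₁·s₂` with `t, t′ ∈ Λ ∖ 0` and `λ(Λ/(t)) ≤ λ(Λ/(t′))`, then `λ(H/Λz) + λ(Λ/μ̃₁) ≤ λ(H/Λz₁) + λ(Λ/μ̃)`.
Subsumes (B≡|RATIO) (`t, t′` constants) and (B≤|DVD) (`t` constant). With the landed stations (E) (GLOBAL trivialisation `e`,
`OnePairPins.exists_trivialisation`) and (R) in its proof-internal shape `C ν·e(𝒸 z) = C k·(𝔯̃_e(c′)·μ̃)·(L⁻·U)` (`U` a unit,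
`StationR.Road.hERL_of_scaledColumnValues`), `t/t′` ARE `C·C·U·𝔯̃_e(c′)` / `C·C·U₁·𝔯̃_e(c′₁)` — so the balance hypothesis is
FRAME-TERM λ-MONOTONICITY `λ(Λ/𝔯̃_e(c′)) ≤ λ(Λ/𝔯̃_e(c′₁))` (see `childB_pair_of_sharpR`). -/
theorem slack_le_of_balanced_ratio {H : Type u} [AddCommGroup H] [Module (PowerSeries A) H] [Module A H]
    [IsScalarTower A (PowerSeries A) H] {z z₁ : H} (hz : ∀ a : PowerSeries A, a • z = 0 → a = 0)
    (hz₁ : ∀ a : PowerSeries A, a • z₁ = 0 → a = 0) {s₁ s₂ μt μt₁ t t' : PowerSeries A}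
    (hs₁ : s₁ ≠ 0) (hs₂ : s₂ ≠ 0) (hμ : μt ≠ 0) (hμ₁ : μt₁ ≠ 0) (ht : t ≠ 0) (ht' : t' ≠ 0)
    (hcomm : s₁ • z = s₂ • z₁)
    (hrel : t * μt * s₁ = t' * μt₁ * s₂)
    (hbal : Module.finrank K (K ⊗[A] (PowerSeries A ⧸ Ideal.span {t})) ≤
      Module.finrank K (K ⊗[A] (PowerSeries A ⧸ Ideal.span {t'})))
    [Module.Finite K (K ⊗[A] (H ⧸ Submodule.span (PowerSeries A) ({z₁} : Set H)))] :
    Module.finrank K (K ⊗[A] (H ⧸ Submodule.span (PowerSeries A) ({z} : Set H))) +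
        Module.finrank K (K ⊗[A] (PowerSeries A ⧸ Ideal.span {μt₁})) ≤
      Module.finrank K (K ⊗[A] (H ⧸ Submodule.span (PowerSeries A) ({z₁} : Set H))) +
        Module.finrank K (K ⊗[A] (PowerSeries A ⧸ Ideal.span {μt})) := by
  have hA2 := slack_eq_of_smul_eq_smul K hz hz₁ hs₁ hs₂ hcomm
  have hl : Module.finrank K (K ⊗[A] (PowerSeries A ⧸ Ideal.span {t * μt * s₁})) =
      Module.finrank K (K ⊗[A] (PowerSeries A ⧸ Ideal.span {s₁})) +
        (Module.finrank K (K ⊗[A] (PowerSeries A ⧸ Ideal.span {μt})) +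
          Module.finrank K (K ⊗[A] (PowerSeries A ⧸ Ideal.span {t}))) := by
    rw [CharIdealLambda.finrank_baseChange_quotient_span_mul_eq_add K (mul_ne_zero ht hμ) hs₁,
      CharIdealLambda.finrank_baseChange_quotient_span_mul_eq_add K ht hμ]
  have hr : Module.finrank K (K ⊗[A] (PowerSeries A ⧸ Ideal.span {t' * μt₁ * s₂})) =
      Module.finrank K (K ⊗[A] (PowerSeries A ⧸ Ideal.span {s₂})) +
        (Module.finrank K (K ⊗[A] (PowerSeries A ⧸ Ideal.span {μt₁})) +
          Module.finrank K (K ⊗[A] (PowerSeries A ⧸ Ideal.span {t'}))) := by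
    rw [CharIdealLambda.finrank_baseChange_quotient_span_mul_eq_add K (mul_ne_zero ht' hμ₁) hs₂,
      CharIdealLambda.finrank_baseChange_quotient_span_mul_eq_add K ht' hμ₁]
  rw [hrel] at hl
  omega

/-- **The consumer arithmetic (weakest sufficient form of the (ii_λ)-half relative to a witness):** a ONE-SIDED slack comparison
`λz + λμ̃₁ ≤ λz₁ + λμ̃` towards the witness and (LAM₁) `λz₁ ≤ λS + λμ̃₁` give `λz ≤ λS + λμ̃`. -/
theorem iiLam_of_slack_le {lz lz₁ lm lm₁ lS : ℕ} (hle : lz + lm₁ ≤ lz₁ + lm) (h₁ : lz₁ ≤ lS + lm₁) : lz ≤ lS + lm := by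
  omega

end Generic

/-! ## §2 Over the tree: torsion-freeness of valued classes from station (R); the (ii_fin)-half and the pair form of child B -/

section Tree

variable {S : Set (PadicAlgCl 2)} {W : WeierstrassCurve ℚ} [W.IsElliptic] {κ : ZpExtension ℚ 2} {γ : absoluteGaloisGroup ℚ}
  {S₀ : Finset (HeightOneSpectrum (𝓞 ℚ))} {n : ℕ} {ρ : FramedGaloisRep ℚ ↥(padicCoeffIntegers S) 2}
  {Θ : ∀ v : HeightOneSpectrum (𝓞 ℚ), ((2 : ℕ) : 𝓞 ℚ) ∈ v.asIdeal → (Cofree ρ ↥(padicCoeffField S) ≃+ (Fin n → ↥(W.geomPrimaryTorsion 2)))}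
  {hΘ : ∀ v hv (δ : absoluteGaloisGroup (v.adicCompletion ℚ)) m i,
    Θ v hv (resGalOfEmb (closureEmb (K := ℚ) (v.adicCompletion ℚ)) δ • m) i = resGalOfEmb (closureEmb (K := ℚ) (v.adicCompletion ℚ)) δ • Θ v hv m i}
  {I : Kato2004.IwasawaH1DataCoeff (FramedGaloisRep.toGaloisRep ρ) 2 κ γ}
  {Sg : AddSubgroup (subgroupH1 κ.kerSubgroup (Cofree ρ ↥(padicCoeffField S)))} [Module ↥(padicCoeffIntegers S) ↥Sg]
  (π : OnePairPins S W κ γ S₀ n ρ Θ hΘ I Sg)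

/-- **(T1) a class whose coordinate column `e(𝒸 z)` is non-zero is `Λ_𝒪`-torsion-free** (given the `Λ_𝒪`-linearity of `e ∘ 𝒸` on
`Λ_𝒪 z`, the same hypothesis station (R) consumes): `a•z = 0 ⇒ a·e(𝒸 z) = e(𝒸 0) = 0 ⇒ a = 0` in the domain `Λ_𝒪`.
[cite: Kobayashi2003, Thm. 6.2 (p. 18)] -/
theorem smul_eq_zero_imp_of_cvec_ne_zero {z : I.H} (e : (Fin n → PowerSeries ℤ_[2]) ≃+ IwasawaAlgebraO S)
    (hlin : ∀ (s : IwasawaAlgebraO S) (x : I.H), x ∈ Submodule.span (IwasawaAlgebraO S) ({z} : Set I.H) →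
      e (π.cvec (s • x)) = s * e (π.cvec x))
    (hne : e (π.cvec z) ≠ 0) : ∀ a : IwasawaAlgebraO S, a • z = 0 → a = 0 := by
  intro a ha
  have h1 := hlin a z (Submodule.mem_span_singleton_self z)
  have h0 := hlin 0 z (Submodule.mem_span_singleton_self z)
  rw [zero_smul, zero_mul] at h0
  rw [ha, h0] at h1
  exact (mul_eq_zero.mp h1.symm).resolve_right hne

/-- **(T1′) station (R)'s landed output forces `e(𝒸 z) ≠ 0`:** `C ν·e(𝒸 z) = μ̃·(L⁻·u)` with `μ̃, L⁻, u ≠ 0`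
(`OnePair.stub_kzgValueRelation`, p725106). Hence EVERY valued class is torsion-free — K0b («rank one») is not needed for this.
[cite: Kato2004Asterisque, Thm. 16.6 (p. 252)] -/
theorem cvec_ne_zero_of_valueRelation {z : I.H} (e : (Fin n → PowerSeries ℤ_[2]) ≃+ IwasawaAlgebraO S)
    {ν : ↥(padicCoeffIntegers S)} {u μt Lm : IwasawaAlgebraO S} (hu : u ≠ 0) (hμ : μt ≠ 0) (hLm : Lm ≠ 0)
    (hrel : PowerSeries.C ν * e (π.cvec z) = μt * (Lm * u)) : e (π.cvec z) ≠ 0 := by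
  intro h0
  rw [h0, mul_zero] at hrel
  exact mul_ne_zero hμ (mul_ne_zero hLm hu) hrel.symm

variable [IsDiscreteValuationRing (coeffO S)] [IsAdicComplete (IsLocalRing.maximalIdeal (coeffO S)) (coeffO S)]
  [Module ↥(padicCoeffIntegers S) I.H] [IsScalarTower ↥(padicCoeffIntegers S) (IwasawaAlgebraO S) I.H]

/-- **(T2) THE (ii_fin)-HALF OF THE ∀-CHILD-B, modulo (FIN₁) of ONE class — PROVED, K0b-free, no `Module.Finite Λ_𝒪 𝐇¹`:**
if `Frac𝒪 ⊗ 𝐇¹/Λz₁` is finite for one class `z₁` then for every torsion-free `z` (every valued class, by (T1)+(T1′)):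
`Frac𝒪 ⊗ 𝐇¹/Λz` is finite AND `z` is commensurable with `z₁` (`s₁•z = s₂•z₁`, `s₁ s₂ ≠ 0`).
[cite: Kato2004Asterisque, Thm. 12.5 (p. 222), §13.8 (p. 228)] [cite: Washington1997, §13.2] -/
theorem childBFin_of_witness {z₁ : I.H}
    (hfin₁ : Module.Finite (FractionRing (coeffO S)) (TensorProduct (coeffO S) (FractionRing (coeffO S)) (zetaQuot I z₁)))
    {z : I.H} (hz : ∀ a : IwasawaAlgebraO S, a • z = 0 → a = 0) :
    Module.Finite (FractionRing (coeffO S)) (TensorProduct (coeffO S) (FractionRing (coeffO S)) (zetaQuot I z)) ∧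
      ∃ s₁ s₂ : IwasawaAlgebraO S, s₁ ≠ 0 ∧ s₂ ≠ 0 ∧ s₁ • z = s₂ • z₁ := by
  haveI := hfin₁
  have htors : Module.IsTorsion (IwasawaAlgebraO S) (zetaQuot I z₁) :=
    isTorsion_of_finite_baseChange (FractionRing (coeffO S))
  obtain ⟨s₁, s₂, hs₁, hs₂, h⟩ := exists_smul_eq_smul_of_isTorsion htors hz
  refine ⟨?_, s₁, s₂, hs₁, hs₂, h⟩
  have hmem : s₂ • z₁ ∈ Submodule.span (IwasawaAlgebraO S) ({z} : Set I.H) := by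
    rw [← h]
    exact Submodule.smul_mem _ _ (Submodule.mem_span_singleton_self z)
  exact finite_baseChange_quot_of_smul_mem (FractionRing (coeffO S)) hs₂ hmem

/-- **(T4) THE ONE REMAINING ANALYTIC STATION, TYPED (nothing asserted): the RATIO RELATION between two valued classes at a frame.**
For valued classes `(z, …, μ̃)`, `(z′, …, μ̃′)` and any commensurability `s₁•z = s₂•z′` (`s₁ s₂ ≠ 0`):
`C a·μ̃·s₁ = C a′·μ̃′·s₂` for some `a, a′ ∈ 𝒪 ∖ 0` — «values pin `q·μ̃` up to `Frac 𝒪`» (stations (U)+(Θ)+(P) of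
Ideas/stub-cmlambdalower-k1-g31: even-character trivialisation + `Θ*(z) = 0` + the identity principle `D_finite_zeros`).
[cite: Kato2004Asterisque, Thm. 16.6 (2) (p. 252)] [cite: Rohrlich1984, Theorem (p. 409)] [cite: Washington1997, §7.2] -/
def RatioRelationStatement [W.IsGloballyMinimal] {M : ℕ} [NeZero M] (g : CuspForm (CongruenceSubgroup.Gamma0 M) 2)
    (ι : ModularForms.coeffField g →+* PadicAlgCl 2) (Ω : ℂ) : Prop :=
  ∀ (Φ : AlgebraicClosure ℚ_[2] ≃ₐ[ℚ] AlgebraicClosure (π.v.adicCompletion ℚ))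
    (τ : ∀ m : ℕ, ZMod (2 ^ m) → Field.absoluteGaloisGroup ℚ_[2])
    (z z' : I.H) (c' c'' : Fin n → ↥(padicCoeffIntegers S)) (w w' : ℕ → Fin π.nb → PadicAlgCl 2) (q q' : PadicAlgCl 2)
    (μt μt' : IwasawaAlgebraO S),
    π.KatoValuedClass g ι Ω Φ τ z c' w q μt → π.KatoValuedClass g ι Ω Φ τ z' c'' w' q' μt' →
    ∀ s₁ s₂ : IwasawaAlgebraO S, s₁ ≠ 0 → s₂ ≠ 0 → s₁ • z = s₂ • z' →
      ∃ a a' : ↥(padicCoeffIntegers S), a ≠ 0 ∧ a' ≠ 0 ∧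
        (PowerSeries.C a : IwasawaAlgebraO S) * μt * s₁ = (PowerSeries.C a' : IwasawaAlgebraO S) * μt' * s₂

/-- **(T3) THE PAIR FORM OF CHILD B — PROVED modulo the ratio relation of the pair:** from (FIN₁)+(LAM₁) at a torsion-free class
`z₁` with multiplier `μ̃₁ ≠ 0` (Kato's class: «Kato125AB»), a torsion-free class `z` with `μ̃ ≠ 0` (any valued class), and the
ratio relation for `(z, z₁)`, BOTH conjuncts of the ∀-child-B's conclusion hold at `(z, μ̃)`:
`Frac𝒪 ⊗ 𝐇¹/Λz` finite ∧ `λ(𝐇¹/Λz) ≤ λ(X₀) + λ(Λ/μ̃)`.  (T2) for (ii_fin) and commensurability, (B≡|RATIO) for the slack, then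
the consumer arithmetic. [cite: Kato2004Asterisque, Thm. 12.5 (p. 222), §13.8 (p. 228)] [cite: Washington1997, §13.2] -/
theorem childB_pair_of_witness {z₁ z : I.H} {μt₁ μt : IwasawaAlgebraO S}
    (hz₁ : ∀ a : IwasawaAlgebraO S, a • z₁ = 0 → a = 0) (hz : ∀ a : IwasawaAlgebraO S, a • z = 0 → a = 0)
    (hμ₁ : μt₁ ≠ 0) (hμ : μt ≠ 0)
    (hfin₁ : Module.Finite (FractionRing (coeffO S)) (TensorProduct (coeffO S) (FractionRing (coeffO S)) (zetaQuot I z₁)))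
    (hlam₁ : lamO S (zetaQuot I z₁) ≤ lamO S (CharacterModule ↥π.Sel₀) + lamO S (IwasawaAlgebraO S ⧸ Ideal.span {μt₁}))
    (hratio : ∀ s₁ s₂ : IwasawaAlgebraO S, s₁ ≠ 0 → s₂ ≠ 0 → s₁ • z = s₂ • z₁ →
      ∃ a a' : ↥(padicCoeffIntegers S), a ≠ 0 ∧ a' ≠ 0 ∧
        (PowerSeries.C a : IwasawaAlgebraO S) * μt * s₁ = (PowerSeries.C a' : IwasawaAlgebraO S) * μt₁ * s₂) :
    Module.Finite (FractionRing (coeffO S)) (TensorProduct (coeffO S) (FractionRing (coeffO S)) (zetaQuot I z)) ∧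
      lamO S (zetaQuot I z) ≤ lamO S (CharacterModule ↥π.Sel₀) + lamO S (IwasawaAlgebraO S ⧸ Ideal.span {μt}) := by
  obtain ⟨hfin, s₁, s₂, hs₁, hs₂, hcomm⟩ := childBFin_of_witness hfin₁ hz
  refine ⟨hfin, ?_⟩
  obtain ⟨a, a', ha, ha', hrat⟩ := hratio s₁ s₂ hs₁ hs₂ hcomm
  haveI := hfin₁
  -- (B≡|RATIO) in the seam's `lamO` currency (`lamO_eq` is definitional; term-mode ascription as in `OnePair.s3body_of_stations`)
  have hslack : lamO S (zetaQuot I z) + lamO S (IwasawaAlgebraO S ⧸ Ideal.span {μt₁}) =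
      lamO S (zetaQuot I z₁) + lamO S (IwasawaAlgebraO S ⧸ Ideal.span {μt}) :=
    slack_invariance_of_ratio (FractionRing (coeffO S)) hz hz₁ hs₁ hs₂ hμ hμ₁ ha ha' hcomm hrat
  exact iiLam_of_slack_le (le_of_eq hslack) hlam₁

/-- **(T3≤) The pair form of child B from the ONE-SIDED station** («`μ̃₁·s₂ ∣ C a·μ̃·s₁`», `t` arbitrary): same conclusion as
`childB_pair_of_witness`, strictly weaker analytic input (`slack_le_of_dvd_ratio` + `iiLam_of_slack_le`). -/
theorem childB_pair_of_witness_dvd {z₁ z : I.H} {μt₁ μt : IwasawaAlgebraO S}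
    (hz₁ : ∀ a : IwasawaAlgebraO S, a • z₁ = 0 → a = 0) (hz : ∀ a : IwasawaAlgebraO S, a • z = 0 → a = 0)
    (hμ₁ : μt₁ ≠ 0) (hμ : μt ≠ 0)
    (hfin₁ : Module.Finite (FractionRing (coeffO S)) (TensorProduct (coeffO S) (FractionRing (coeffO S)) (zetaQuot I z₁)))
    (hlam₁ : lamO S (zetaQuot I z₁) ≤ lamO S (CharacterModule ↥π.Sel₀) + lamO S (IwasawaAlgebraO S ⧸ Ideal.span {μt₁}))
    (hdvd : ∀ s₁ s₂ : IwasawaAlgebraO S, s₁ ≠ 0 → s₂ ≠ 0 → s₁ • z = s₂ • z₁ →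
      ∃ (a : ↥(padicCoeffIntegers S)) (t : IwasawaAlgebraO S), a ≠ 0 ∧ t ≠ 0 ∧
        (PowerSeries.C a : IwasawaAlgebraO S) * μt * s₁ = t * μt₁ * s₂) :
    Module.Finite (FractionRing (coeffO S)) (TensorProduct (coeffO S) (FractionRing (coeffO S)) (zetaQuot I z)) ∧
      lamO S (zetaQuot I z) ≤ lamO S (CharacterModule ↥π.Sel₀) + lamO S (IwasawaAlgebraO S ⧸ Ideal.span {μt}) := by
  obtain ⟨hfin, s₁, s₂, hs₁, hs₂, hcomm⟩ := childBFin_of_witness hfin₁ hz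
  refine ⟨hfin, ?_⟩
  obtain ⟨a, t, ha, ht, hrat⟩ := hdvd s₁ s₂ hs₁ hs₂ hcomm
  haveI := hfin₁
  have hslack : lamO S (zetaQuot I z) + lamO S (IwasawaAlgebraO S ⧸ Ideal.span {μt₁}) ≤
      lamO S (zetaQuot I z₁) + lamO S (IwasawaAlgebraO S ⧸ Ideal.span {μt}) :=
    slack_le_of_dvd_ratio (FractionRing (coeffO S)) hz hz₁ hs₁ hs₂ hμ hμ₁ ha ht hcomm hrat
  exact iiLam_of_slack_le hslack hlam₁

/-- **(T5) CHILD B FROM THE LANDED STATIONS' SHAPES + FRAME-TERM λ-MONOTONICITY (the sharpest reduction of this sketch).**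
Inputs, all visible in the tree: the GLOBAL trivialisation `e` of `OnePairPins.exists_trivialisation` (station (E), p722652:
`e(𝒸(s•x)) = s·e(𝒸 x)` for ALL `x`); station (R)'s relation IN THE SHAPE ITS PROOF PRODUCES at two valued classes
(`StationR.values_identity` + `StationR.Road.hERL_of_scaledColumnValues`: `C ν·e(𝒸 z) = C k·(𝔯̃·μ̃)·(L⁻·U)`, `U` a unit,
`𝔯̃ = 𝔯̃_e(c′) = Σ C(c′ᵢ)·e(δᵢ) ≠ 0` the frame term — `OnePair.stub_kzgValueRelation` hides `𝔯̃·C k·U` in its `∃ u`);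
(FIN₁)+(LAM₁) at the witness `z₁` («Kato125AB»); and ONE inequality between the two FRAME TERMS,
`λ(Λ/𝔯̃_e(c′)) ≤ λ(Λ/𝔯̃_e(c′₁))` — automatic when `e` is coefficientwise (`e(δᵢ) = C bᵢ`: both sides `0`).
Output: the ∀-child-B conjuncts (ii_fin) ∧ (ii_λ) at `(z, μ̃)`.  No K0b, no `Module.Finite Λ_𝒪 𝐇¹`, no values, no `L`-functions. -/
theorem childB_pair_of_sharpR {z₁ z : I.H} {μt₁ μt Lm rt rt₁ U U₁ : IwasawaAlgebraO S} {ν ν₁ k k₁ : ↥(padicCoeffIntegers S)}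
    (e : (Fin n → PowerSeries ℤ_[2]) ≃+ IwasawaAlgebraO S)
    (hlin : ∀ (s : IwasawaAlgebraO S) (x : I.H), e (π.cvec (s • x)) = s * e (π.cvec x))
    (hLm : Lm ≠ 0) (hν : ν ≠ 0) (hν₁ : ν₁ ≠ 0) (hk : k ≠ 0) (hk₁ : k₁ ≠ 0) (hU : IsUnit U) (hU₁ : IsUnit U₁)
    (hrt : rt ≠ 0) (hrt₁ : rt₁ ≠ 0) (hμ₁ : μt₁ ≠ 0) (hμ : μt ≠ 0)
    (hR : PowerSeries.C ν * e (π.cvec z) = PowerSeries.C k * (rt * μt) * (Lm * U))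
    (hR₁ : PowerSeries.C ν₁ * e (π.cvec z₁) = PowerSeries.C k₁ * (rt₁ * μt₁) * (Lm * U₁))
    (hfin₁ : Module.Finite (FractionRing (coeffO S)) (TensorProduct (coeffO S) (FractionRing (coeffO S)) (zetaQuot I z₁)))
    (hlam₁ : lamO S (zetaQuot I z₁) ≤ lamO S (CharacterModule ↥π.Sel₀) + lamO S (IwasawaAlgebraO S ⧸ Ideal.span {μt₁}))
    (hframe : lamO S (IwasawaAlgebraO S ⧸ Ideal.span {rt}) ≤ lamO S (IwasawaAlgebraO S ⧸ Ideal.span {rt₁})) :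
    Module.Finite (FractionRing (coeffO S)) (TensorProduct (coeffO S) (FractionRing (coeffO S)) (zetaQuot I z)) ∧
      lamO S (zetaQuot I z) ≤ lamO S (CharacterModule ↥π.Sel₀) + lamO S (IwasawaAlgebraO S ⧸ Ideal.span {μt}) := by
  -- torsion-freeness of both classes from the column relation (T1/T1′)
  have hz : ∀ a : IwasawaAlgebraO S, a • z = 0 → a = 0 :=
    smul_eq_zero_imp_of_cvec_ne_zero π e (fun s x _ => hlin s x)
      (cvec_ne_zero_of_valueRelation π e (ν := ν) (u := rt * (PowerSeries.C k * U)) (mul_ne_zero hrt (mul_ne_zero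
        (fun h0 => hk (by simpa using congrArg PowerSeries.constantCoeff h0)) hU.ne_zero)) hμ hLm
        (by rw [hR]; ring))
  have hz₁ : ∀ a : IwasawaAlgebraO S, a • z₁ = 0 → a = 0 :=
    smul_eq_zero_imp_of_cvec_ne_zero π e (fun s x _ => hlin s x)
      (cvec_ne_zero_of_valueRelation π e (ν := ν₁) (u := rt₁ * (PowerSeries.C k₁ * U₁)) (mul_ne_zero hrt₁ (mul_ne_zero
        (fun h0 => hk₁ (by simpa using congrArg PowerSeries.constantCoeff h0)) hU₁.ne_zero)) hμ₁ hLm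
        (by rw [hR₁]; ring))
  obtain ⟨hfin, s₁, s₂, hs₁, hs₂, hcomm⟩ := childBFin_of_witness hfin₁ hz
  refine ⟨hfin, ?_⟩
  haveI := hfin₁
  -- commensurability read through the GLOBAL linear functional `e ∘ 𝒸`
  have h1 : s₁ * e (π.cvec z) = s₂ * e (π.cvec z₁) := by rw [← hlin, ← hlin, hcomm]
  -- the balanced ratio relation, `L⁻` cancelled
  have h2 : PowerSeries.C ν₁ * PowerSeries.C k * (U * rt) * μt * s₁ * Lm =
      PowerSeries.C ν * PowerSeries.C k₁ * (U₁ * rt₁) * μt₁ * s₂ * Lm := by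
    linear_combination (-(PowerSeries.C ν₁ * s₁)) * hR + (PowerSeries.C ν * s₂) * hR₁ +
      (PowerSeries.C ν * PowerSeries.C ν₁) * h1
  have h3 : PowerSeries.C ν₁ * PowerSeries.C k * (U * rt) * μt * s₁ =
      PowerSeries.C ν * PowerSeries.C k₁ * (U₁ * rt₁) * μt₁ * s₂ := mul_right_cancel₀ hLm h2
  have hC : ∀ {a : ↥(padicCoeffIntegers S)}, a ≠ 0 → (PowerSeries.C a : IwasawaAlgebraO S) ≠ 0 :=
    fun ha h0 => ha (by simpa using congrArg PowerSeries.constantCoeff h0)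
  have ht : PowerSeries.C ν₁ * PowerSeries.C k * (U * rt) ≠ 0 :=
    mul_ne_zero (mul_ne_zero (hC hν₁) (hC hk)) (mul_ne_zero hU.ne_zero hrt)
  have ht' : PowerSeries.C ν * PowerSeries.C k₁ * (U₁ * rt₁) ≠ 0 :=
    mul_ne_zero (mul_ne_zero (hC hν) (hC hk₁)) (mul_ne_zero hU₁.ne_zero hrt₁)
  have hbal : Module.finrank (FractionRing (coeffO S)) (TensorProduct (coeffO S) (FractionRing (coeffO S))
        (IwasawaAlgebraO S ⧸ Ideal.span {PowerSeries.C ν₁ * PowerSeries.C k * (U * rt)})) ≤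
      Module.finrank (FractionRing (coeffO S)) (TensorProduct (coeffO S) (FractionRing (coeffO S))
        (IwasawaAlgebraO S ⧸ Ideal.span {PowerSeries.C ν * PowerSeries.C k₁ * (U₁ * rt₁)})) := by
    rw [finrank_baseChange_quot_span_C_mul_C_mul_unit_mul (FractionRing (coeffO S)) hν₁ hk hU hrt,
      finrank_baseChange_quot_span_C_mul_C_mul_unit_mul (FractionRing (coeffO S)) hν hk₁ hU₁ hrt₁]
    exact hframe
  have hslack : lamO S (zetaQuot I z) + lamO S (IwasawaAlgebraO S ⧸ Ideal.span {μt₁}) ≤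
      lamO S (zetaQuot I z₁) + lamO S (IwasawaAlgebraO S ⧸ Ideal.span {μt}) :=
    slack_le_of_balanced_ratio (FractionRing (coeffO S)) hz hz₁ hs₁ hs₂ hμ hμ₁ ht ht' hcomm h3 hbal
  exact iiLam_of_slack_le hslack hlam₁

/-- **(E♭) THE COEFFICIENTWISE GLOBAL TRIVIALISATION — typed station = a RE-EXPORT of the tree's construction.** Station (E)
(`OnePairPins.exists_trivialisation`) builds `e` through `PriceNode.exists_trivialisation` = `PriceNode.exists_coeffwise_addEquiv Φ`
(`coeff m (e t) = Φ⁻¹((coeff m (t i))_i)`), so `e(δᵢ) = C (Φ⁻¹ δᵢ)` IS a constant; the exported `∃` forgets it.  This Prop asks for it back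
(third conjunct); proof = re-run the 20-line construction keeping `he`'s coefficient formula.  TYPED ONLY. -/
def CoeffwiseTrivialisationStatement [W.IsGloballyMinimal] [FiniteDimensional ℚ_[2] ↥(padicCoeffField S)] : Prop :=
  Rank1Residual.GoodSS W 2 → W.frobeniusTrace 2 = 0 → κ.IsTopGenerator γ →
    ∃ e : (Fin n → PowerSeries ℤ_[2]) ≃+ IwasawaAlgebraO S,
      (∀ (r : PowerSeries ℤ_[2]) (t : Fin n → PowerSeries ℤ_[2]), e (r • t) = PowerSeries.map (padicIntToCoeffIntegers S) r * e t) ∧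
      (∀ (s : IwasawaAlgebraO S) (x : I.H), e (π.cvec (s • x)) = s * e (π.cvec x)) ∧
      ∀ i : Fin n, ∃ b : ↥(padicCoeffIntegers S), e (Pi.single i 1) = PowerSeries.C b

omit [IsDiscreteValuationRing (coeffO S)] [IsAdicComplete (IsLocalRing.maximalIdeal (coeffO S)) (coeffO S)]
  [Module ↥(padicCoeffIntegers S) I.H] [IsScalarTower ↥(padicCoeffIntegers S) (IwasawaAlgebraO S) I.H] in
/-- **With a coefficientwise `e` the frame term is a constant:** `𝔯̃_e(c′) = Σ C(c′ᵢ)·e(δᵢ) = C(Σ c′ᵢ bᵢ)`.  So (R)'s hidden multiplier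
`u = 𝔯̃·C u₀·u′` (`StationR.Road.hERL_of_scaledColumnValues`) is a CONSTANT TIMES A UNIT — the shape (R♭) consumed below. -/
theorem rtilde_eq_C_of_coeffwise (e : (Fin n → PowerSeries ℤ_[2]) ≃+ IwasawaAlgebraO S) {b : Fin n → ↥(padicCoeffIntegers S)}
    (hcoef : ∀ i : Fin n, e (Pi.single i 1) = PowerSeries.C (b i)) (c' : Fin n → ↥(padicCoeffIntegers S)) :
    (∑ i : Fin n, PowerSeries.C (c' i) * e (Pi.single i 1)) = PowerSeries.C (∑ i : Fin n, c' i * b i) := by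
  rw [map_sum]
  exact Finset.sum_congr rfl fun i _ => by rw [hcoef i, map_mul]

/-- **(T6) CHILD B AT EVERY VALUED CLASS FROM «Kato125AB» + TWO RE-EXPORTS OF LANDED PROOFS — the end of the reduction.**
With the GLOBAL coefficientwise `e` ((E♭)) and (R) in the shape (R♭) «`C ν·e(𝒸 z) = C k·μ̃·(L⁻·U)`, `U` a unit» at the class AND at the
witness, (FIN₁)+(LAM₁) at the witness give (ii_fin) ∧ (ii_λ) at `(z, μ̃)` — `childB_pair_of_sharpR` with trivial frame terms
(`𝔯̃ = 1`, `hframe := le_rfl`).  The ∀-child-B is therefore «Kato125AB» (∃-form, print) + (E♭) + (R♭) + this file; BSD is NOT proved. -/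
theorem childB_pair_of_constUnitR {z₁ z : I.H} {μt₁ μt Lm U U₁ : IwasawaAlgebraO S} {ν ν₁ k k₁ : ↥(padicCoeffIntegers S)}
    (e : (Fin n → PowerSeries ℤ_[2]) ≃+ IwasawaAlgebraO S)
    (hlin : ∀ (s : IwasawaAlgebraO S) (x : I.H), e (π.cvec (s • x)) = s * e (π.cvec x))
    (hLm : Lm ≠ 0) (hν : ν ≠ 0) (hν₁ : ν₁ ≠ 0) (hk : k ≠ 0) (hk₁ : k₁ ≠ 0) (hU : IsUnit U) (hU₁ : IsUnit U₁)
    (hμ₁ : μt₁ ≠ 0) (hμ : μt ≠ 0)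
    (hR : PowerSeries.C ν * e (π.cvec z) = PowerSeries.C k * μt * (Lm * U))
    (hR₁ : PowerSeries.C ν₁ * e (π.cvec z₁) = PowerSeries.C k₁ * μt₁ * (Lm * U₁))
    (hfin₁ : Module.Finite (FractionRing (coeffO S)) (TensorProduct (coeffO S) (FractionRing (coeffO S)) (zetaQuot I z₁)))
    (hlam₁ : lamO S (zetaQuot I z₁) ≤ lamO S (CharacterModule ↥π.Sel₀) + lamO S (IwasawaAlgebraO S ⧸ Ideal.span {μt₁})) :
    Module.Finite (FractionRing (coeffO S)) (TensorProduct (coeffO S) (FractionRing (coeffO S)) (zetaQuot I z)) ∧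
      lamO S (zetaQuot I z) ≤ lamO S (CharacterModule ↥π.Sel₀) + lamO S (IwasawaAlgebraO S ⧸ Ideal.span {μt}) :=
  childB_pair_of_sharpR π e hlin hLm hν hν₁ hk hk₁ hU hU₁ one_ne_zero one_ne_zero hμ₁ hμ
    (by rw [one_mul]; exact hR) (by rw [one_mul]; exact hR₁) hfin₁ hlam₁ le_rfl

end Tree

end Summit.BirchSwinnertonDyer.BirchSwinnertonDyer.Cruxes.ResidualThetaCountLowerPureAtTwo.SideaK1G34

end
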